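import Summits.CriticalPhenomena.PercolationContinuityZ3.Theorems.PercNearOneGluingNoHeavyLowerTailAntitheticConeMixedShift
import HarnessLib

/-!
# `NoHeavyLowerTail` (stmt-CriticalPhenomena-4575) — antithetic cluster pairs: **LEMMA D2Q (a degree-2 vertex on `s` and `P`) and
# THEOREM TE — `K_{2,k}` FROM A POLE PLUS AN EAR from the other pole to a middle, for EVERY `k`**, structurally (no certificate):
# CONJECTURE Δ2 / the vertex antithetic inequality at `R = {x}` at the ear vertex next to the middle (prim-hp-2 gen 68,
# HOME/MEMO-gen68.md §1; announced on paper as "THEOREM TE" in HOME/MEMO-gen67.md §0(5))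

Support file (`--supports stmt-CriticalPhenomena-4575`, hull-port prover `prim-hp-2`, gen 68).  No definitions, no named facts, no sorries;
standard axioms.  VERTEX version, setting and notation of …AntitheticConeFibre / …AntitheticConeMixedShift (`T ⊆ Sym2 V` the red pairs,
`X T = openCluster (T ∩ E) s` the red and `Y T = openCluster (Tᶜ ∩ E) s` the blue vertex cluster of the source `s`).

THE QUANTITY.  With a `z`-arm of length `0` the shifted handle principle (…AntitheticHandlePrincipleShift) needs only
  (M)_shift(E; P, Q):  `0 ≤ Σ_{T : P ∈ X T, Q ∉ Y T} (F⁺(X T) − F⁻(Y T))·(G⁺(X T) − G⁻(Y T))`  for all monotone `F⁻ ≤ F⁺`, `G⁻ ≤ G⁺`.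
THEOREM M1 (…AntitheticConeMixedShift) settles it for rooted cones at an edge; `K_{2,k}` rooted at a pole is not a cone and fails the
(⊕) hypothesis in every form for `k ≥ 5` (HOME/MEMO-gen67.md §4), yet its mixed sums at (pole, middle) are nonnegative for all `k`:

**LEMMA D2Q** (`NestedTop.mixed_shift_nonneg`).  Let `Q` be a vertex of `E` whose only pairs are `sQ` and `QP` (`s, P, Q` distinct as far
as needed: `s ≠ Q`, `P ≠ Q`).  Split the sum according to the colours of `sQ, QP`:
* `sQ` blue: `Q ∈ Y T`, no event;
* `sQ, QP` red: the event is automatic (`s – Q – P` red, and a blue path to `Q` would end in a blue pair at `Q`), so this part is the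
  CYLINDER sum `Σ_{T ⊇ {sQ, QP}} f g` (`f = F⁺∘X − F⁻∘Y`), which is `¼ Σ_{T'} (f g)(T' ∪ {sQ, QP})` (uniform block Fubini `Cone.sum_block`)
  and nonnegative by `Cone.shift_full_sum_nonneg` (Harris in `T'` + the marginal domination `Σ F⁻∘Y ≤ Σ F⁻∘X ≤ Σ F⁺∘X`) —
  `NestedTop.cylinder_shift_sum_nonneg`;
* `sQ` red, `QP` blue: `Q ∉ Y T` forces `P ∉ Y T`, so the event is the TOP EVENT `{P ∈ X T ∖ Y T}` ("diagonal" mixed event `y = z`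
  of the M-census).  If the tops of `E` at `P` are NESTED — `P ∈ X T ∖ Y T ⇒ Y T ⊆ X T` — every term is nonnegative:
  `F⁻(Y T) ≤ F⁻(X T) ≤ F⁺(X T)`.
Hence (M)_shift(E; P, Q) ≥ 0 for every `E` with nested tops at `P` and such a `Q`.

**NESTED TOPS FOR THETAS OF LENGTH 2** (`NestedTop.theta_nested`).  If every pair of `E` at `s` is a spoke `sm` to a set `M` of "middles",
every middle `m` has no pairs other than `sm`, `mc`, and `mc ∈ E` for every middle (`c ∉ M`; further pairs avoiding `s` and `M` — a block hung
at `c` — are free), then the tops of `E` at `c` are nested: the blue cluster of `s` consists of `s` and middles `m` with `sm` blue; `mc` blue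
would put `c` into `Y T`, so `mc` is red and `m ∈ X T` as soon as `c ∈ X T`.  (Thetas with an `s–c` path of length ≥ 3 are NOT nested.)

**THEOREM TE** (`NestedTop.theta_ear_vertex_sum_nonneg`).  `E₀` as above and loop-free, `Q ∈ M` with `sQ ∈ E₀` (so `Q` is a middle of
degree 2: every `K_{2,k}` on the poles `s, c`, `k ≥ 1`, with any graph hung at `c`); an arm `c = u 0, u 1, …, u a = y` of fresh vertices;
`x` fresh joined to `y` and to `Q` (`y ≠ Q`, `yQ ∉ E₀ ∪ arm`, so `a ≥ 1`).  Then for all monotone `F, G`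
  `0 ≤ Σ_{ω : ¬(x ∈ X_E ω ∧ x ∈ Y_E ω)} (F(X_E ω) − F(Y_E ω))·(G(X_E ω) − G(Y_E ω))`,  `E = (E₀ ∪ arm) + xQ + xy`
— the vertex antithetic inequality at `R = {x}` / CONJECTURE Δ2 for `K_{2,k}` plus an ear `c – … – x – m` of length ≥ 3, ALL `k`
(…AntitheticK25Ear is the certified instance `k = 5`; `K_{2,5}`, `K_{2,6}` fail ⊕_shift: −3, not separable).  Proof: the shifted handle
principle `Pendant.handle_vertex_sum_nonneg_of_shift` with `b = 0` (its (⊕_j) hypotheses are vacuous) and LEMMA D2Q.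
[cite: VandenbergHaggstromKahn2005, §1 p. 6 ("Harris' inequality"), §1 p. 3 (open cluster `C_s`)]
-/

noncomputable section

namespace Summit.CriticalPhenomena.PercolationContinuityZ3.Theorems

open Literature.Probability.Percolation
open scoped Classical

namespace Antithetic

namespace NestedTop

variable {V : Type*} [Fintype V]

/-- **Cylinder sums of the shifted class are nonnegative.**  For any pair set `M` and monotone nested `F⁻ ≤ F⁺`, `G⁻ ≤ G⁺`:
`0 ≤ Σ_{T ⊇ M} (F⁺(X T) − F⁻(Y T))·(G⁺(X T) − G⁻(Y T))` — by uniform block Fubini (`Cone.sum_block`) this is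
`|Set (Sym2 V)| / #{T ⊇ M}` times... rather `#{T ⊇ M}·Σ_{T'} (fg)(T' ∪ M) = |Set (Sym2 V)|·Σ_{T ⊇ M} (fg)(T)`, and the full sum with `M`
forced red is nonnegative (`Cone.shift_full_sum_nonneg`). [this work] -/
theorem cylinder_shift_sum_nonneg (E : Set (Sym2 V)) (s : V) (M : Set (Sym2 V)) (Fp Fm Gp Gm : Set V → ℝ)
    (hFp : Monotone Fp) (hFm : Monotone Fm) (hF : ∀ S, Fm S ≤ Fp S) (hGp : Monotone Gp) (hGm : Monotone Gm) (hG : ∀ S, Gm S ≤ Gp S) :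
    0 ≤ ∑ T ∈ Finset.univ.filter (fun T : Set (Sym2 V) => M ⊆ T),
      (Fp (openCluster (T ∩ E) s) - Fm (openCluster (Tᶜ ∩ E) s)) * (Gp (openCluster (T ∩ E) s) - Gm (openCluster (Tᶜ ∩ E) s)) := by
  set N : ℝ := (Fintype.card (Set (Sym2 V)) : ℝ) with hN
  have hNpos : 0 < N := by rw [hN]; exact_mod_cast Fintype.card_pos
  let h : Set (Sym2 V) → ℝ := fun T =>
    (Fp (openCluster (T ∩ E) s) - Fm (openCluster (Tᶜ ∩ E) s)) * (Gp (openCluster (T ∩ E) s) - Gm (openCluster (Tᶜ ∩ E) s))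
  -- the full shifted sum with `M` forced red is nonnegative
  have hfull : 0 ≤ ∑ T' : Set (Sym2 V), h (T' ∪ M) :=
    TwoStage.Cone.shift_full_sum_nonneg E s M Fp Fm Gp Gm hFp hFm hF hGp hGm hG
  -- uniform block Fubini with the block `M`
  have hblock := TwoStage.Cone.sum_block M (fun a b : Set (Sym2 V) => if a = M then h (b ∪ M) else 0)
  have hsubiff : ∀ T : Set (Sym2 V), T ∩ M = M ↔ M ⊆ T := fun T => Set.inter_eq_right
  have hL : ∑ T : Set (Sym2 V), ∑ T' : Set (Sym2 V), (fun a b : Set (Sym2 V) => if a = M then h (b ∪ M) else 0) (T ∩ M) (T' \ M)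
      = (∑ T : Set (Sym2 V), (if M ⊆ T then (1 : ℝ) else 0)) * ∑ T' : Set (Sym2 V), h (T' ∪ M) := by
    rw [Finset.sum_mul]
    refine Finset.sum_congr rfl fun T _ => ?_
    show ∑ T', (if T ∩ M = M then h (T' \ M ∪ M) else 0) = _
    by_cases hMT : M ⊆ T
    · rw [if_pos hMT, one_mul]
      exact Finset.sum_congr rfl fun T' _ => by rw [if_pos ((hsubiff T).2 hMT), Set.sdiff_union_self]
    · rw [if_neg hMT, zero_mul]
      exact Finset.sum_eq_zero fun T' _ => by rw [if_neg (fun h' => hMT ((hsubiff T).1 h'))]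
  have hR : ∑ T : Set (Sym2 V), (fun a b : Set (Sym2 V) => if a = M then h (b ∪ M) else 0) (T ∩ M) (T \ M)
      = ∑ T ∈ Finset.univ.filter (fun T : Set (Sym2 V) => M ⊆ T), h T := by
    rw [Finset.sum_filter]
    refine Finset.sum_congr rfl fun T _ => ?_
    show (if T ∩ M = M then h (T \ M ∪ M) else 0) = if M ⊆ T then h T else 0
    by_cases hMT : M ⊆ T
    · rw [if_pos ((hsubiff T).2 hMT), if_pos hMT, Set.sdiff_union_of_subset hMT]
    · rw [if_neg (fun h' => hMT ((hsubiff T).1 h')), if_neg hMT]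
  rw [hL, hR] at hblock
  have hcnt : 0 ≤ ∑ T : Set (Sym2 V), (if M ⊆ T then (1 : ℝ) else 0) :=
    Finset.sum_nonneg fun T _ => by split_ifs <;> norm_num
  have h2 : 0 ≤ N * ∑ T ∈ Finset.univ.filter (fun T : Set (Sym2 V) => M ⊆ T), h T := by
    rw [← hblock]; exact mul_nonneg hcnt hfull
  exact (mul_nonneg_iff_of_pos_left hNpos).1 h2

/-- **LEMMA D2Q with nested tops.**  `Q` a vertex whose only pairs in `E` are `sQ` and `QP` (both present, `s ≠ Q`, `P ≠ Q`), and the tops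
of `E` at `P` NESTED (`P ∈ X T`, `P ∉ Y T` ⇒ `Y T ⊆ X T`).  Then for all monotone `F⁻ ≤ F⁺`, `G⁻ ≤ G⁺`:
`0 ≤ Σ_{T : P ∈ X T, Q ∉ Y T} (F⁺(X T) − F⁻(Y T))·(G⁺(X T) − G⁻(Y T))` — hypothesis (M)_shift of the shifted handle principle for the
core `E` at `(P, Q)`.  (Cylinder over `{sQ, QP}` red + the termwise-nonnegative top event.) [this work] -/
theorem mixed_shift_nonneg (E : Set (Sym2 V)) (s P Q : V) (hsQ : s ≠ Q) (hPQ : P ≠ Q)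
    (hsQE : s(s, Q) ∈ E) (hQPE : s(Q, P) ∈ E) (hdeg : ∀ e ∈ E, Q ∈ e → e = s(s, Q) ∨ e = s(Q, P))
    (hnest : ∀ T : Set (Sym2 V), P ∈ openCluster (T ∩ E) s → P ∉ openCluster (Tᶜ ∩ E) s →
      openCluster (Tᶜ ∩ E) s ⊆ openCluster (T ∩ E) s)
    (Fp Fm Gp Gm : Set V → ℝ) (hFp : Monotone Fp) (hFm : Monotone Fm) (hF : ∀ S, Fm S ≤ Fp S)
    (hGp : Monotone Gp) (hGm : Monotone Gm) (hG : ∀ S, Gm S ≤ Gp S) :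
    0 ≤ ∑ T ∈ Finset.univ.filter (fun T : Set (Sym2 V) => P ∈ openCluster (T ∩ E) s ∧ Q ∉ openCluster (Tᶜ ∩ E) s),
      (Fp (openCluster (T ∩ E) s) - Fm (openCluster (Tᶜ ∩ E) s)) * (Gp (openCluster (T ∩ E) s) - Gm (openCluster (Tᶜ ∩ E) s)) := by
  -- a vertex `v ≠ s` reached from `s` in `η` has an `η`-pair at it
  have hlast : ∀ {η : Set (Sym2 V)} {v : V}, v ≠ s → (openGraph η).Reachable s v → ∃ u, s(v, u) ∈ η := by
    intro η v hvs hr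
    obtain ⟨p⟩ := hr
    cases hp : p.reverse with
    | nil => exact absurd rfl hvs
    | cons hadj _ =>
      rw [openGraph_adj] at hadj
      exact ⟨_, hadj.1⟩
  -- both pairs at `Q` red ⇒ `Q ∉ Y T`
  have hQY : ∀ T : Set (Sym2 V), s(s, Q) ∈ T → s(Q, P) ∈ T → Q ∉ openCluster (Tᶜ ∩ E) s := by
    intro T h1 h2 hQ
    obtain ⟨u, hu⟩ := hlast hsQ.symm hQ
    rcases hdeg _ hu.2 (Sym2.mem_mk_left Q u) with h | h
    · exact hu.1 (h ▸ h1)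
    · exact hu.1 (h ▸ h2)
  -- `sQ` blue ⇒ `Q ∈ Y T`
  have hQY' : ∀ T : Set (Sym2 V), s(s, Q) ∉ T → Q ∈ openCluster (Tᶜ ∩ E) s := fun T hT =>
    TwoStage.Cone.mem_cluster_of_adj (mem_openCluster_self _ s) ((openGraph_adj _ s Q).2 ⟨⟨hT, hsQE⟩, hsQ⟩)
  -- both red ⇒ `P ∈ X T`
  have hPX : ∀ T : Set (Sym2 V), s(s, Q) ∈ T → s(Q, P) ∈ T → P ∈ openCluster (T ∩ E) s := fun T h1 h2 =>
    TwoStage.Cone.mem_cluster_of_adj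
      (TwoStage.Cone.mem_cluster_of_adj (mem_openCluster_self _ s) ((openGraph_adj _ s Q).2 ⟨⟨h1, hsQE⟩, hsQ⟩))
      ((openGraph_adj _ Q P).2 ⟨⟨h2, hQPE⟩, hPQ.symm⟩)
  -- split the event along the colour of `QP`
  rw [← Finset.sum_filter_add_sum_filter_not _ (fun T : Set (Sym2 V) => s(Q, P) ∈ T), Finset.filter_filter, Finset.filter_filter]
  refine add_nonneg ?_ (Finset.sum_nonneg fun T hT => ?_)
  · -- `QP` red: the event is the cylinder `{sQ, QP} ⊆ T`
    have hev : Finset.univ.filter (fun T : Set (Sym2 V) =>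
          (P ∈ openCluster (T ∩ E) s ∧ Q ∉ openCluster (Tᶜ ∩ E) s) ∧ s(Q, P) ∈ T) =
        Finset.univ.filter (fun T : Set (Sym2 V) => ({s(s, Q), s(Q, P)} : Set (Sym2 V)) ⊆ T) := by
      refine Finset.filter_congr fun T _ => ⟨fun hT => ?_, fun hT => ?_⟩
      · have h1 : s(s, Q) ∈ T := by_contra fun hc => hT.1.2 (hQY' T hc)
        intro e he
        rcases he with rfl | he
        · exact h1
        · rw [Set.mem_singleton_iff.1 he]; exact hT.2
      · have h1 : s(s, Q) ∈ T := hT (Set.mem_insert _ _)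
        have h2 : s(Q, P) ∈ T := hT (Set.mem_insert_of_mem _ rfl)
        exact ⟨⟨hPX T h1 h2, hQY T h1 h2⟩, h2⟩
    rw [hev]
    exact cylinder_shift_sum_nonneg E s _ Fp Fm Gp Gm hFp hFm hF hGp hGm hG
  · -- `QP` blue: the top event, termwise nonnegative
    rw [Finset.mem_filter] at hT
    obtain ⟨-, ⟨hPXT, hQYT⟩, hQP⟩ := hT
    have hPY : P ∉ openCluster (Tᶜ ∩ E) s := fun hP =>
      hQYT (TwoStage.Cone.mem_cluster_of_adj hP ((openGraph_adj _ P Q).2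
        ⟨⟨by rw [Sym2.eq_swap]; exact hQP, by rw [Sym2.eq_swap]; exact hQPE⟩, hPQ⟩))
    have hYX := hnest T hPXT hPY
    exact mul_nonneg (sub_nonneg.2 ((hFm hYX).trans (hF _))) (sub_nonneg.2 ((hGm hYX).trans (hG _)))

omit [Fintype V] in
/-- **Nested tops for thetas of length 2 (any block at the far pole).**  If every pair of `E` at `s` is a spoke `sm` with `m ∈ M`, every
`m ∈ M` lies only on the pairs `sm`, `mc`, and `mc ∈ E` for all `m ∈ M` (`c ∉ M`), then `c ∈ X T`, `c ∉ Y T` imply `Y T ⊆ X T`.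
[this work] -/
theorem theta_nested (E : Set (Sym2 V)) (s c : V) (M : Set V) (hcM : c ∉ M)
    (hs : ∀ e ∈ E, s ∈ e → ∃ m ∈ M, e = s(s, m))
    (hM : ∀ m ∈ M, ∀ e ∈ E, m ∈ e → e = s(s, m) ∨ e = s(m, c))
    (hMc : ∀ m ∈ M, s(m, c) ∈ E) (T : Set (Sym2 V))
    (hcX : c ∈ openCluster (T ∩ E) s) (hcY : c ∉ openCluster (Tᶜ ∩ E) s) :
    openCluster (Tᶜ ∩ E) s ⊆ openCluster (T ∩ E) s := by
  let S : Set V := {v | v ∈ openCluster (T ∩ E) s ∧ v ∈ openCluster (Tᶜ ∩ E) s ∧ (v = s ∨ v ∈ M)}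
  have hsub : openCluster (Tᶜ ∩ E) s ⊆ S := by
    refine TwoStage.Fan.cluster_subset_of_closed ⟨mem_openCluster_self _ s, mem_openCluster_self _ s, Or.inl rfl⟩ ?_
    intro u w hu huw
    obtain ⟨huX, huY, hu'⟩ := hu
    have hwY : w ∈ openCluster (Tᶜ ∩ E) s := TwoStage.Cone.mem_cluster_of_adj huY huw
    obtain ⟨⟨hTc, hE⟩, hne⟩ := (openGraph_adj _ u w).1 huw
    rcases hu' with rfl | huM
    · -- `u = s`: the pair is a spoke to a middle `w`, whose pair to `c` must be red
      obtain ⟨m, hmM, hm⟩ := hs _ hE (Sym2.mem_mk_left _ w)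
      have hwm : w = m := by
        rcases Sym2.eq_iff.1 hm with ⟨-, h⟩ | ⟨-, h⟩
        · exact h
        · exact absurd h.symm hne
      subst hwm
      have hwc : w ≠ c := fun h => hcM (h ▸ hmM)
      refine ⟨?_, hwY, Or.inr hmM⟩
      by_cases hred : s(w, c) ∈ T
      · exact TwoStage.Cone.mem_cluster_of_adj hcX ((openGraph_adj _ c w).2
          ⟨⟨by rw [Sym2.eq_swap]; exact hred, by rw [Sym2.eq_swap]; exact hMc w hmM⟩, hwc.symm⟩)
      · exact absurd (TwoStage.Cone.mem_cluster_of_adj hwY ((openGraph_adj _ w c).2 ⟨⟨hred, hMc w hmM⟩, hwc⟩)) hcY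
    · -- `u ∈ M`: the pair goes back to `s`, or to `c` — which would put `c` into `Y T`
      rcases hM u huM _ hE (Sym2.mem_mk_left u w) with h | h
      · have hws : w = s := by
          rcases Sym2.eq_iff.1 h with ⟨h1, h2⟩ | ⟨-, h2⟩
          · exact h2.trans h1
          · exact h2
        subst hws
        exact ⟨mem_openCluster_self _ _, hwY, Or.inl rfl⟩
      · have hwc : w = c := by
          rcases Sym2.eq_iff.1 h with ⟨-, h2⟩ | ⟨h1, h2⟩
          · exact h2
          · exact h2.trans h1
        subst hwc
        exact absurd hwY hcY
  exact fun v hv => (hsub hv).1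

/-- **THEOREM TE (`K_{2,k}` + ear from the far pole to a middle, all `k`, all lengths; any block hung at the far pole).**  `E₀` loop-free
whose pairs at `s` are spokes to `M`, each `m ∈ M` lying only on `sm`, `mc` with `mc ∈ E₀` (`c ∉ M`), and `Q ∈ M` with `sQ ∈ E₀`, `s ≠ Q`;
an arm `c = u 0, u 1, …, u a = y` of fresh vertices; `x` fresh, joined to `y` and to `Q` (`y ≠ Q`, `yQ ∉ E₀ ∪ arm`).  Then for all
monotone `F, G`: `0 ≤ Σ_{ω : ¬(x ∈ X_E ω ∧ x ∈ Y_E ω)} (F(X_E ω) − F(Y_E ω))·(G(X_E ω) − G(Y_E ω))`, `E = (E₀ ∪ arm) + xQ + xy`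
— the vertex antithetic inequality at `R = {x}` / CONJECTURE Δ2. [this work] -/
theorem theta_ear_vertex_sum_nonneg {E₀ : Set (Sym2 V)} {s c Q : V} {M : Set V} {u : ℕ → V} {a : ℕ}
    (hnd : ∀ f ∈ E₀, ¬ f.IsDiag) (hcM : c ∉ M) (hQM : Q ∈ M) (hsQ : s ≠ Q)
    (hs : ∀ e ∈ E₀, s ∈ e → ∃ m ∈ M, e = s(s, m))
    (hM : ∀ m ∈ M, ∀ e ∈ E₀, m ∈ e → e = s(s, m) ∨ e = s(m, c))
    (hMc : ∀ m ∈ M, s(m, c) ∈ E₀) (hsQE : s(s, Q) ∈ E₀)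
    (hu0 : u 0 = c) (hufresh : ∀ i, 0 < i → i ≤ a → ∀ f ∈ E₀, u i ∈ f → f.IsDiag)
    (huinj : ∀ i j, i ≤ a → j ≤ a → u i = u j → i = j) (hsu : ∀ i, 0 < i → i ≤ a → s ≠ u i) (hQu : ∀ i, 0 < i → i ≤ a → Q ≠ u i)
    {x : V} (hx : ∀ f ∈ E₀ ∪ Cyc.edgeSet a u, x ∈ f → f.IsDiag) (hxs : x ≠ s) (hxy : x ≠ u a) (hxQ : x ≠ Q) (hyQ : u a ≠ Q)
    (hg : s(u a, Q) ∉ E₀ ∪ Cyc.edgeSet a u)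
    {F G : Set V → ℝ} (hF : Monotone F) (hG : Monotone G) :
    0 ≤ ∑ ω ∈ Finset.univ.filter (fun ω : Set (Sym2 V) =>
        ¬ ((openGraph (ω ∩ insert s(x, Q) (insert s(x, u a) (E₀ ∪ Cyc.edgeSet a u)))).Reachable s x ∧
          (openGraph (ωᶜ ∩ insert s(x, Q) (insert s(x, u a) (E₀ ∪ Cyc.edgeSet a u)))).Reachable s x)),
      (F (openCluster (ω ∩ insert s(x, Q) (insert s(x, u a) (E₀ ∪ Cyc.edgeSet a u))) s) -
          F (openCluster (ωᶜ ∩ insert s(x, Q) (insert s(x, u a) (E₀ ∪ Cyc.edgeSet a u))) s)) *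
        (G (openCluster (ω ∩ insert s(x, Q) (insert s(x, u a) (E₀ ∪ Cyc.edgeSet a u))) s) -
          G (openCluster (ωᶜ ∩ insert s(x, Q) (insert s(x, u a) (E₀ ∪ Cyc.edgeSet a u))) s)) := by
  have hQc : Q ≠ c := fun h => hcM (h ▸ hQM)
  -- (M)_shift(E₀; c, Q) by LEMMA D2Q and the nested tops of the theta
  have hmix : ∀ Fp Fm Gp Gm : Set V → ℝ, Monotone Fp → Monotone Fm → (∀ S, Fm S ≤ Fp S) →
      Monotone Gp → Monotone Gm → (∀ S, Gm S ≤ Gp S) →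
      0 ≤ ∑ T ∈ Finset.univ.filter (fun T : Set (Sym2 V) =>
          c ∈ openCluster (T ∩ E₀) s ∧ Q ∉ openCluster (Tᶜ ∩ E₀) s),
        (Fp (openCluster (T ∩ E₀) s) - Fm (openCluster (Tᶜ ∩ E₀) s)) *
          (Gp (openCluster (T ∩ E₀) s) - Gm (openCluster (Tᶜ ∩ E₀) s)) :=
    fun Fp Fm Gp Gm hFp hFm hF' hGp hGm hG' =>
      mixed_shift_nonneg E₀ s c Q hsQ hQc.symm hsQE (hMc Q hQM) (fun e he hQe => hM Q hQM e he hQe)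
        (fun T hcX hcY => theta_nested E₀ s c M hcM hs hM hMc T hcX hcY) Fp Fm Gp Gm hFp hFm hF' hGp hGm hG'
  -- the `z`-arm of length `0`
  let w : ℕ → V := fun _ => Q
  have hw0 : w 0 = Q := rfl
  have hE : Cyc.edgeSet a u ∪ E₀ = (Cyc.edgeSet a u ∪ E₀) ∪ Cyc.edgeSet 0 w := by
    rw [TwoStage.Cone.edgeSet_zero, Set.union_empty]
  have hufresh' : ∀ i, 0 < i → i ≤ a → ∀ f ∈ E₀ ∪ Cyc.edgeSet 0 w, u i ∈ f → f.IsDiag := by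
    intro i hi hia f hf huf
    rw [TwoStage.Cone.edgeSet_zero, Set.union_empty] at hf
    exact hufresh i hi hia f hf huf
  have hx' : ∀ f ∈ Cyc.edgeSet a u ∪ E₀, x ∈ f → f.IsDiag := by rw [Set.union_comm]; exact hx
  have hg' : s(u a, Q) ∉ Cyc.edgeSet a u ∪ E₀ := by rw [Set.union_comm]; exact hg
  have h := Pendant.handle_vertex_sum_nonneg_of_shift (E₀ := E₀) (s := s) (P := c) (Q := Q) (u := u) (w := w) (a := a) (b := 0)
    hu0 hw0 hufresh' (fun i hi hib => absurd hib (by omega)) huinj (fun i j hi hj _ => by omega) hsu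
    (fun i hi hib => absurd hib (by omega)) (fun i hi hib => absurd hib (by omega)) hQu
    (fun j hj => absurd hj (Nat.not_lt_zero j)) hmix hnd (x := x) (by rw [← hE]; exact hx') hxs hxy hxQ hyQ (by rw [← hE]; exact hg')
    hF hG
  rw [← hE, hw0] at h
  have hset : insert s(x, Q) (insert s(x, u a) (E₀ ∪ Cyc.edgeSet a u)) = insert s(x, u a) (insert s(x, Q) (Cyc.edgeSet a u ∪ E₀)) := by
    rw [Set.insert_comm, Set.union_comm]
  rw [hset]
  convert h using 3

/-! ### Apex side sets: the general nested-tops criterion and THEOREM AE (appended, gen 68)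

The theta lemma is the case `A = {s} ∪ M` of a general criterion: if `P` is adjacent to every vertex (other than `s`) of an `s`-SIDE `A`
(`s ∈ A ∌ P`, pairs of `E` leave `A` only towards `P`), the tops at `P` are nested.  With LEMMA D2Q this gives **THEOREM AE**: for an
ARBITRARY graph on `A ∋ s` in which `Q` is a pendant neighbour of `s`, the core `E₀ =` (that graph) `+` (the join of `P` with `A ∖ {s}`,
`sP` optional) `+` (anything hung at `P`), plus an ear `P – u 1 – … – y – x – Q`, satisfies the vertex antithetic inequality at `R = {x}`.
New beyond cones-at-the-root (THEOREM CE: there the apex is the source `s`; here the apex `P` is the far end of the ear and the graph on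
the `s`-side is unrestricted). -/

omit [Fintype V] in
/-- **Nested tops under an apex.**  Let `A ∋ s` be a set of vertices with `P ∉ A` such that every pair of `E` with an end in `A` has its
other end in `A ∪ {P}` (the `s`-side of `P`; anything hung at `P` is free) and `P` is adjacent to every vertex of `A ∖ {s}`.  Then
`P ∈ X T`, `P ∉ Y T` imply `Y T ⊆ X T`: the blue cluster of `s` stays in `A` (it cannot pass through `P`), and for `v ∈ Y T ∖ {s}` the pair
`vP ∈ E` is red (blue would put `P` into `Y T`), so `v ∈ X T`. [this work] -/
theorem apex_nested (E : Set (Sym2 V)) (s P : V) (A : Set V) (hsA : s ∈ A)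
    (hcl : ∀ e ∈ E, ∀ u ∈ e, u ∈ A → ∀ w ∈ e, w ∈ A ∨ w = P)
    (hadj : ∀ v ∈ A, v ≠ s → s(v, P) ∈ E) (T : Set (Sym2 V))
    (hPX : P ∈ openCluster (T ∩ E) s) (hPY : P ∉ openCluster (Tᶜ ∩ E) s) :
    openCluster (Tᶜ ∩ E) s ⊆ openCluster (T ∩ E) s := by
  -- the blue cluster of `s` stays inside `A`
  have hYA : openCluster (Tᶜ ∩ E) s ⊆ {v | v ∈ A ∧ v ∈ openCluster (Tᶜ ∩ E) s} := by
    refine TwoStage.Fan.cluster_subset_of_closed ⟨hsA, mem_openCluster_self _ s⟩ ?_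
    intro u w hu huw
    have hwY : w ∈ openCluster (Tᶜ ∩ E) s := TwoStage.Cone.mem_cluster_of_adj hu.2 huw
    obtain ⟨⟨-, hE⟩, -⟩ := (openGraph_adj _ u w).1 huw
    rcases hcl _ hE u (Sym2.mem_mk_left u w) hu.1 w (Sym2.mem_mk_right u w) with hwA | hwP
    · exact ⟨hwA, hwY⟩
    · exact absurd (hwP ▸ hwY) hPY
  intro v hv
  by_cases hvs : v = s
  · rw [hvs]; exact mem_openCluster_self _ s
  · have hvA : v ∈ A := (hYA hv).1
    have hvP : v ≠ P := fun h => hPY (h ▸ hv)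
    by_cases hred : s(v, P) ∈ T
    · exact TwoStage.Cone.mem_cluster_of_adj hPX ((openGraph_adj _ P v).2
        ⟨⟨by rw [Sym2.eq_swap]; exact hred, by rw [Sym2.eq_swap]; exact hadj v hvA hvs⟩, hvP.symm⟩)
    · exact absurd (TwoStage.Cone.mem_cluster_of_adj hv ((openGraph_adj _ v P).2 ⟨⟨hred, hadj v hvA hvs⟩, hvP⟩)) hPY

/-- **THEOREM AE (apex over the `s`-side + ear to a degree-2 neighbour of `s`, all lengths).**  `E₀` loop-free; `A ∋ s` a vertex set with
`P ∉ A`, every pair of `E₀` with an end in `A` having its other end in `A ∪ {P}`, and `P` adjacent to every vertex of `A ∖ {s}` (so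
`E₀ = ` an ARBITRARY graph on `A` + the join of `P` with `A ∖ {s}` (± `sP`) + anything hung at `P`); `Q ∈ A`, `Q ≠ s`, `sQ ∈ E₀`, and `Q` on
no pair of `E₀` other than `sQ`, `QP`; an arm `P = u 0, u 1, …, u a = y` of fresh vertices; `x` fresh, joined to `y` and `Q` (`y ≠ Q`,
`yQ ∉ E₀ ∪ arm`).  Then for all monotone `F, G`: `0 ≤ Σ_{ω : ¬(x ∈ X_E ω ∧ x ∈ Y_E ω)} (F(X_E ω) − F(Y_E ω))·(G(X_E ω) − G(Y_E ω))`,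
`E = (E₀ ∪ arm) + xQ + xy` — the vertex antithetic inequality at `R = {x}` / CONJECTURE Δ2.  THEOREM TE is the case `A = {s} ∪ M`.
[this work] -/
theorem apex_ear_vertex_sum_nonneg {E₀ : Set (Sym2 V)} {s P Q : V} {A : Set V} {u : ℕ → V} {a : ℕ}
    (hnd : ∀ f ∈ E₀, ¬ f.IsDiag) (hsA : s ∈ A) (hPA : P ∉ A) (hQA : Q ∈ A) (hsQ : s ≠ Q)
    (hcl : ∀ e ∈ E₀, ∀ v ∈ e, v ∈ A → ∀ w ∈ e, w ∈ A ∨ w = P)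
    (hadj : ∀ v ∈ A, v ≠ s → s(v, P) ∈ E₀) (hsQE : s(s, Q) ∈ E₀)
    (hdeg : ∀ e ∈ E₀, Q ∈ e → e = s(s, Q) ∨ e = s(Q, P))
    (hu0 : u 0 = P) (hufresh : ∀ i, 0 < i → i ≤ a → ∀ f ∈ E₀, u i ∈ f → f.IsDiag)
    (huinj : ∀ i j, i ≤ a → j ≤ a → u i = u j → i = j) (hsu : ∀ i, 0 < i → i ≤ a → s ≠ u i) (hQu : ∀ i, 0 < i → i ≤ a → Q ≠ u i)
    {x : V} (hx : ∀ f ∈ E₀ ∪ Cyc.edgeSet a u, x ∈ f → f.IsDiag) (hxs : x ≠ s) (hxy : x ≠ u a) (hxQ : x ≠ Q) (hyQ : u a ≠ Q)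
    (hg : s(u a, Q) ∉ E₀ ∪ Cyc.edgeSet a u)
    {F G : Set V → ℝ} (hF : Monotone F) (hG : Monotone G) :
    0 ≤ ∑ ω ∈ Finset.univ.filter (fun ω : Set (Sym2 V) =>
        ¬ ((openGraph (ω ∩ insert s(x, Q) ((E₀ ∪ Cyc.edgeSet a u) ∪ {s(x, u a)}))).Reachable s x ∧
          (openGraph (ωᶜ ∩ insert s(x, Q) ((E₀ ∪ Cyc.edgeSet a u) ∪ {s(x, u a)}))).Reachable s x)),
      (F (openCluster (ω ∩ insert s(x, Q) ((E₀ ∪ Cyc.edgeSet a u) ∪ {s(x, u a)})) s) -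
          F (openCluster (ωᶜ ∩ insert s(x, Q) ((E₀ ∪ Cyc.edgeSet a u) ∪ {s(x, u a)})) s)) *
        (G (openCluster (ω ∩ insert s(x, Q) ((E₀ ∪ Cyc.edgeSet a u) ∪ {s(x, u a)})) s) -
          G (openCluster (ωᶜ ∩ insert s(x, Q) ((E₀ ∪ Cyc.edgeSet a u) ∪ {s(x, u a)})) s)) := by
  have hPQ : P ≠ Q := fun h => hPA (h ▸ hQA)
  -- (M)_shift(E₀; P, Q) by LEMMA D2Q and the nested tops under the apex `P`
  have hmix : ∀ Fp Fm Gp Gm : Set V → ℝ, Monotone Fp → Monotone Fm → (∀ S, Fm S ≤ Fp S) →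
      Monotone Gp → Monotone Gm → (∀ S, Gm S ≤ Gp S) →
      0 ≤ ∑ T ∈ Finset.univ.filter (fun T : Set (Sym2 V) =>
          P ∈ openCluster (T ∩ E₀) s ∧ Q ∉ openCluster (Tᶜ ∩ E₀) s),
        (Fp (openCluster (T ∩ E₀) s) - Fm (openCluster (Tᶜ ∩ E₀) s)) *
          (Gp (openCluster (T ∩ E₀) s) - Gm (openCluster (Tᶜ ∩ E₀) s)) :=
    fun Fp Fm Gp Gm hFp hFm hF' hGp hGm hG' =>
      mixed_shift_nonneg E₀ s P Q hsQ hPQ hsQE (hadj Q hQA hsQ.symm) hdeg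
        (fun T hPX hPY => apex_nested E₀ s P A hsA hcl hadj T hPX hPY) Fp Fm Gp Gm hFp hFm hF' hGp hGm hG'
  -- the `z`-arm of length `0`
  let w : ℕ → V := fun _ => Q
  have hw0 : w 0 = Q := rfl
  have hE : Cyc.edgeSet a u ∪ E₀ = (Cyc.edgeSet a u ∪ E₀) ∪ Cyc.edgeSet 0 w := by
    rw [TwoStage.Cone.edgeSet_zero, Set.union_empty]
  have hufresh' : ∀ i, 0 < i → i ≤ a → ∀ f ∈ E₀ ∪ Cyc.edgeSet 0 w, u i ∈ f → f.IsDiag := by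
    intro i hi hia f hf huf
    rw [TwoStage.Cone.edgeSet_zero, Set.union_empty] at hf
    exact hufresh i hi hia f hf huf
  have hx' : ∀ f ∈ Cyc.edgeSet a u ∪ E₀, x ∈ f → f.IsDiag := by rw [Set.union_comm]; exact hx
  have hg' : s(u a, Q) ∉ Cyc.edgeSet a u ∪ E₀ := by rw [Set.union_comm]; exact hg
  have h := Pendant.handle_vertex_sum_nonneg_of_shift (E₀ := E₀) (s := s) (P := P) (Q := Q) (u := u) (w := w) (a := a) (b := 0)
    hu0 hw0 hufresh' (fun i hi hib => absurd hib (by omega)) huinj (fun i j hi hj _ => by omega) hsu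
    (fun i hi hib => absurd hib (by omega)) (fun i hi hib => absurd hib (by omega)) hQu
    (fun j hj => absurd hj (Nat.not_lt_zero j)) hmix hnd (x := x) (by rw [← hE]; exact hx') hxs hxy hxQ hyQ (by rw [← hE]; exact hg')
    hF hG
  rw [← hE, hw0] at h
  have hset : insert s(x, Q) ((E₀ ∪ Cyc.edgeSet a u) ∪ {s(x, u a)}) = insert s(x, u a) (insert s(x, Q) (Cyc.edgeSet a u ∪ E₀)) := by
    rw [Set.union_singleton, Set.insert_comm, Set.union_comm]
  rw [hset]
  convert h using 3

end NestedTop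

end Antithetic

end Summit.CriticalPhenomena.PercolationContinuityZ3.Theorems
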